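/-
Copyright (c) 2026. All rights reserved.
Released under Apache 2.0 license as described in the file LICENSE.
Authors: abc-iut cell, prover seat abc-iut-f-101 (F fact-proving wave).
-/
import Literature.AnabelianGeometry.AbsoluteAnabelian.DiagramLifts
import Literature.AnabelianGeometry.AbsoluteAnabelian.DiagramTelecoreFamilies

/-!
# Families of homotopies generated by whiskered generator pairs ([AbsTopIII] Def. 3.5 (ii)–(iii), toolkit)

S. Mochizuki, *Topics in Absolute Anabelian Geometry III*, §0 p. 26 (saturated sets of co-verticial pairs: diagonal,
transitivity, pre- and post-composition) and Def. 3.5 (ii)–(iii) pp. 75–76 (families of homotopies; observables), kurims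
manuscript `paper:url-5493eb38cbb7`, bib key `MochizukiAbsTopIII2015`.

The toolkits in the tree build families of homotopies whose homotopies are ISOMORPHISMS through structure functors
(`DiagramCores`, `DiagramLifts`, `DiagramUniversalFamilies`, `DiagramTelecoreFamilies`) or IDENTITIES between equal
path functors (`strictFamily`, `LogFrobeniusLogWallIndependence`).  The observables `S_log`, `S_log⊞` of [AbsTopIII]
Cor. 5.5 (iii) (and `𝔖_log` of Cor. 3.6 (iii)) are of neither kind: their homotopies are the NON-invertible natural
transformations `ι_{v,ε}` induced by the arrows of the graph `Γ⃗^log_v` of Def. 5.4 (iii)/(v).  This file provides the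
missing constructor, in the generality of an arbitrary diagram of categories `𝒟` and a vertex `ω` without outgoing
edges (the observation vertex):

* GENERATORS: any type-valued family `Gen g g'` of "generator pairs" of co-verticial paths with prescribed homotopies
  `genHom : 𝒟_[g] ⟶ 𝒟_[g']`;
* `Move` = a generator pair preceded by a common path `r` (`p = g ∘ r`, `p' = g' ∘ r`), with homotopy
  `Move.hom = 𝒟_[r] ◁ genHom` (`moveHom`; Def. 3.5 (ii), third axiom); `Chain` = a finite chain of moves, with
  homotopy the composite (`Chain.hom`; second axiom); concatenation `append`, prefixing `shift`, and the two laws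
  `hom_append`, `hom_shift_app` (componentwise, plain objects — the `eqToHom` bookkeeping of `pathFunctor`);
* `chainFamily`: GIVEN COHERENCE (`thin`: any two chains between the same two paths into `ω` have the same
  homotopy), the family of homotopies whose boundary set is "pairs into `ω` joined by a chain" (`ChainRel`, saturated:
  `chainRel_isSaturated`) and whose homotopy on a pair is that of any chain (`chainFamily_η`); every boundary path
  ends at `ω` (`chainFamily_terminal`), and a generator pair carries its prescribed homotopy (`chainFamily_η_gen`).

Coherence is exactly what a consumer must supply (for `S_log⊞` it is the commutativity of the `ι⊞`-squares of
`Γ⃗^⋉_v`, cf. `LogFrobeniusObservablesIotaSquare.lean`); this file asserts nothing about any particular diagram.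
Pure category theory; plumbing is `[folklore]`, the statements cite the item of §0 / Def. 3.5 whose bookkeeping they
are.  Nothing here bears on [IUTchIII] Cor. 3.12.
-/

set_option autoImplicit false

namespace Literature.AnabelianGeometry.AbsoluteAnabelian

open _root_.CategoryTheory _root_.Quiver

universe t v u w

namespace DiagramOfCategories

variable {V : Type w} [Quiver.{v} V] (D : DiagramOfCategories.{v, u, w} V)

/-! ## Bookkeeping -/

/-- Transport of a component of a natural transformation along an equality of objects. [folklore] -/
private theorem app_congr_obj' {A B : Type*} [Category A] [Category B] {F G : A ⥤ B} (α : F ⟶ G) {y y' : A}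
    (hy : y = y') : α.app y = eqToHom (by rw [hy]) ≫ α.app y' ≫ eqToHom (by rw [hy]) := by
  subst hy
  simp

/-- The path functor of a path presented as a composite. [cite: MochizukiAbsTopIII2015, Definition 3.5 (i) p.75] -/
theorem pathFunctor_eq_of_eq_comp {a c b : V} {p : Path a b} (r : Path a c) (g : Path c b) (hp : p = r.comp g) :
    D.pathFunctor p = D.pathFunctor r ⋙ D.pathFunctor g := by
  rw [hp, pathFunctor_comp]

/-- The same on objects, with plain objects. [cite: MochizukiAbsTopIII2015, Definition 3.5 (i) p.75] -/
theorem pathFunctor_obj_of_eq_comp {a c b : V} {p : Path a b} (r : Path a c) (g : Path c b) (hp : p = r.comp g)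
    (x : D.obj a) : (D.pathFunctor p).obj x = (D.pathFunctor g).obj ((D.pathFunctor r).obj x) := by
  rw [hp, pathFunctor_comp]; rfl

/-- The functor of a composite path on objects, with plain objects. [cite: MochizukiAbsTopIII2015, Definition 3.5 (i) p.75] -/
theorem pathFunctor_comp_obj {a c b : V} (r : Path a c) (g : Path c b) (x : D.obj a) :
    (D.pathFunctor (r.comp g)).obj x = (D.pathFunctor g).obj ((D.pathFunctor r).obj x) := by
  rw [pathFunctor_comp]; rfl

/-- The functor of the empty path on objects. [cite: MochizukiAbsTopIII2015, Definition 3.5 (i) p.75] -/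
theorem pathFunctor_nil_obj (a : V) (x : D.obj a) : (D.pathFunctor (Path.nil : Path a a)).obj x = x := by
  rw [pathFunctor_nil]; rfl

/-- The functor of the empty path on morphisms. [cite: MochizukiAbsTopIII2015, Definition 3.5 (i) p.75] -/
theorem pathFunctor_nil_map (a : V) {x y : D.obj a} (f : x ⟶ y) :
    (D.pathFunctor (Path.nil : Path a a)).map f =
      eqToHom (D.pathFunctor_nil_obj a x) ≫ f ≫ eqToHom (D.pathFunctor_nil_obj a y).symm := by
  rw [Functor.congr_hom (D.pathFunctor_nil a) f]; rfl

/-! ## The homotopy of a whiskered generator pair ("move") -/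

/-- The homotopy `𝒟_[r ; g] ⟶ 𝒟_[r ; g']` induced by a homotopy `α : 𝒟_[g] ⟶ 𝒟_[g']` of a co-verticial pair
`(g, g')` preceded by a common path `r` (Def. 3.5 (ii), third axiom with trivial right whisker), on paths `p = g ∘ r`,
`p' = g' ∘ r` given by equations. [cite: MochizukiAbsTopIII2015, Definition 3.5 (ii) p.75] -/
noncomputable def moveHom {a c b : V} (r : Path a c) {g g' : Path c b} (α : D.pathFunctor g ⟶ D.pathFunctor g')
    {p p' : Path a b} (hp : p = r.comp g) (hp' : p' = r.comp g') : D.pathFunctor p ⟶ D.pathFunctor p' :=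
  eqToHom (D.pathFunctor_eq_of_eq_comp r g hp) ≫ Functor.whiskerLeft (D.pathFunctor r) α ≫
    eqToHom (D.pathFunctor_eq_of_eq_comp r g' hp').symm

/-- Components of `moveHom` (plain objects). [cite: MochizukiAbsTopIII2015, Definition 3.5 (ii) p.75] -/
theorem moveHom_app {a c b : V} (r : Path a c) {g g' : Path c b} (α : D.pathFunctor g ⟶ D.pathFunctor g')
    {p p' : Path a b} (hp : p = r.comp g) (hp' : p' = r.comp g') (x : D.obj a) :
    (D.moveHom r α hp hp').app x =
      eqToHom (D.pathFunctor_obj_of_eq_comp r g hp x) ≫ α.app ((D.pathFunctor r).obj x) ≫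
        eqToHom (D.pathFunctor_obj_of_eq_comp r g' hp' x).symm := by
  simp only [moveHom, NatTrans.comp_app, eqToHom_app, Functor.whiskerLeft_app]
  rfl

/-- `moveHom` along a longer common prefix is the whiskered `moveHom`, componentwise.
[cite: MochizukiAbsTopIII2015, Definition 3.5 (ii) p.75] -/
theorem moveHom_shift_app {a' a c b : V} (r₁ : Path a' a) (r : Path a c) {g g' : Path c b}
    (α : D.pathFunctor g ⟶ D.pathFunctor g') {p p' : Path a b} (hp : p = r.comp g) (hp' : p' = r.comp g')
    (hq : r₁.comp p = (r₁.comp r).comp g) (hq' : r₁.comp p' = (r₁.comp r).comp g') (x : D.obj a') :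
    (D.moveHom (r₁.comp r) α hq hq').app x =
      eqToHom (D.pathFunctor_comp_obj r₁ p x) ≫ (D.moveHom r α hp hp').app ((D.pathFunctor r₁).obj x) ≫
        eqToHom (D.pathFunctor_comp_obj r₁ p' x).symm := by
  rw [moveHom_app, moveHom_app, app_congr_obj' α (D.pathFunctor_comp_obj r₁ r x)]
  simp only [Category.assoc, eqToHom_trans, eqToHom_trans_assoc]

variable (Gen : ∀ ⦃c b : V⦄, Path c b → Path c b → Type t)
  (genHom : ∀ ⦃c b : V⦄ ⦃g g' : Path c b⦄, Gen g g' → (D.pathFunctor g ⟶ D.pathFunctor g'))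

/-- A **move** from `p` to `p'`: a generator pair `(g, g')` preceded by a common path `r` — `p = g ∘ r`,
`p' = g' ∘ r` (the pre-composition clause (d) of a saturated set, §0 p. 26, applied to a generator).
[cite: MochizukiAbsTopIII2015, Section 0 p.26] -/
structure Move {a b : V} (p p' : Path a b) : Type (max t v w) where
  /-- the intermediate vertex -/
  c : V
  /-- the common prefix -/
  r : Path a c
  /-- the generator pair -/
  g : Path c b
  /-- the generator pair -/
  g' : Path c b
  /-- the generator -/
  s : Gen g g'
  hp : p = r.comp g
  hp' : p' = r.comp g'

namespace Move

variable {D Gen}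

/-- The homotopy of a move: the generator's homotopy whiskered on the left with `𝒟_[r]`.
[cite: MochizukiAbsTopIII2015, Definition 3.5 (ii) p.75] -/
noncomputable def hom {a b : V} {p p' : Path a b} (m : Move Gen p p') : D.pathFunctor p ⟶ D.pathFunctor p' :=
  D.moveHom m.r (genHom m.s) m.hp m.hp'

/-- A move preceded by a further common path. [cite: MochizukiAbsTopIII2015, Section 0 p.26] -/
def shift {a' a b : V} {p p' : Path a b} (r₁ : Path a' a) (m : Move Gen p p') :
    Move Gen (r₁.comp p) (r₁.comp p') :=
  ⟨m.c, r₁.comp m.r, m.g, m.g', m.s, by rw [Path.comp_assoc, ← m.hp], by rw [Path.comp_assoc, ← m.hp']⟩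

/-- The homotopy of a shifted move is the whiskered homotopy, componentwise.
[cite: MochizukiAbsTopIII2015, Definition 3.5 (ii) p.75] -/
theorem shift_hom_app {a' a b : V} {p p' : Path a b} (r₁ : Path a' a) (m : Move Gen p p') (x : D.obj a') :
    ((m.shift r₁).hom genHom).app x =
      eqToHom (D.pathFunctor_comp_obj r₁ p x) ≫ (m.hom genHom).app ((D.pathFunctor r₁).obj x) ≫
        eqToHom (D.pathFunctor_comp_obj r₁ p' x).symm :=
  D.moveHom_shift_app r₁ m.r (genHom m.s) m.hp m.hp' _ _ x

end Move

/-! ## Chains of moves and their homotopies -/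

/-- A **chain** of moves from `p` to `q` (the transitive closure, §0 p. 26 (c)).
[cite: MochizukiAbsTopIII2015, Section 0 p.26] -/
inductive Chain : ∀ {a b : V}, Path a b → Path a b → Type (max t v w)
  | nil {a b : V} (p : Path a b) : Chain p p
  | cons {a b : V} {p p' q : Path a b} (m : Move Gen p p') (rest : Chain p' q) : Chain p q

namespace Chain

variable {D Gen}

/-- The homotopy of a chain: the composite of the homotopies of its moves (Def. 3.5 (ii), second axiom).
[cite: MochizukiAbsTopIII2015, Definition 3.5 (ii) p.75] -/
noncomputable def hom : ∀ {a b : V} {p q : Path a b}, Chain Gen p q → (D.pathFunctor p ⟶ D.pathFunctor q)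
  | _, _, _, _, nil p => 𝟙 _
  | _, _, _, _, cons m rest => m.hom genHom ≫ rest.hom

/-- Concatenation of chains. [cite: MochizukiAbsTopIII2015, Section 0 p.26] -/
def append : ∀ {a b : V} {p q s : Path a b}, Chain Gen p q → Chain Gen q s → Chain Gen p s
  | _, _, _, _, _, nil _, c' => c'
  | _, _, _, _, _, cons m rest, c' => cons m (rest.append c')

/-- A chain preceded by a common path. [cite: MochizukiAbsTopIII2015, Section 0 p.26] -/
def shift {a' a : V} (r₁ : Path a' a) : ∀ {b : V} {p q : Path a b}, Chain Gen p q →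
    Chain Gen (r₁.comp p) (r₁.comp q)
  | _, _, _, nil p => nil (r₁.comp p)
  | _, _, _, cons m rest => cons (m.shift r₁) (rest.shift r₁)

/-- The homotopy of the empty chain. [cite: MochizukiAbsTopIII2015, Definition 3.5 (ii) p.75] -/
@[simp] theorem hom_nil {a b : V} (p : Path a b) : (nil (Gen := Gen) p).hom genHom = 𝟙 (D.pathFunctor p) := by
  rw [hom]

/-- The homotopy of a chain with a first move. [cite: MochizukiAbsTopIII2015, Definition 3.5 (ii) p.75] -/
@[simp] theorem hom_cons {a b : V} {p p' q : Path a b} (m : Move Gen p p') (rest : Chain Gen p' q) :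
    (cons m rest).hom genHom = m.hom genHom ≫ rest.hom genHom := by
  rw [hom]

/-- The homotopy of a concatenation is the composite. [cite: MochizukiAbsTopIII2015, Definition 3.5 (ii) p.75] -/
theorem hom_append : ∀ {a b : V} {p q s : Path a b} (c : Chain Gen p q) (c' : Chain Gen q s),
    (c.append c').hom genHom = c.hom genHom ≫ c'.hom genHom
  | _, _, _, _, _, nil _, c' => by rw [append, hom_nil, Category.id_comp]
  | _, _, _, _, _, cons m rest, c' => by
    rw [append, hom_cons, hom_cons, hom_append rest c', Category.assoc]

/-- The homotopy of a shifted chain is the whiskered homotopy, componentwise (Def. 3.5 (ii), third axiom).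
[cite: MochizukiAbsTopIII2015, Definition 3.5 (ii) p.75] -/
theorem hom_shift_app {a' a : V} (r₁ : Path a' a) : ∀ {b : V} {p q : Path a b} (c : Chain Gen p q) (x : D.obj a'),
    ((c.shift r₁).hom genHom).app x =
      eqToHom (D.pathFunctor_comp_obj r₁ p x) ≫ (c.hom genHom).app ((D.pathFunctor r₁).obj x) ≫
        eqToHom (D.pathFunctor_comp_obj r₁ q x).symm
  | _, _, _, nil p, x => by
    rw [shift, hom_nil, hom_nil, NatTrans.id_app, NatTrans.id_app, Category.id_comp, eqToHom_trans, eqToHom_refl]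
  | _, _, _, cons m rest, x => by
    rw [shift, hom_cons, hom_cons, NatTrans.comp_app, NatTrans.comp_app, Move.shift_hom_app,
      hom_shift_app r₁ rest x]
    simp only [Category.assoc, eqToHom_trans_assoc, eqToHom_refl, Category.id_comp]

end Chain

/-! ## The family of homotopies generated by the moves, into a sink vertex -/

section Family

variable (ω : V) (hout : ∀ b : V, IsEmpty (ω ⟶ b))
  (thin : ∀ {a : V} (p q : Path a ω) (c c' : Chain Gen p q), c.hom genHom = c'.hom genHom)

/-- The boundary set: pairs of paths ENDING AT `ω` joined by a chain of moves (§0 p. 26: the saturation of the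
generator pairs, when `ω` has no outgoing edge). [cite: MochizukiAbsTopIII2015, Section 0 p.27] -/
def ChainRel ⦃a b : V⦄ (p q : Path a b) : Prop := b = ω ∧ Nonempty (Chain Gen p q)

include hout in
/-- It is saturated. [cite: MochizukiAbsTopIII2015, Section 0 p.26] -/
theorem chainRel_isSaturated : IsSaturated (ChainRel Gen ω) where
  refl_left _ _ p _ h := ⟨h.1, ⟨Chain.nil p⟩⟩
  refl_right _ _ _ q h := ⟨h.1, ⟨Chain.nil q⟩⟩
  trans _ _ _ _ _ h₁ h₂ := ⟨h₁.1, ⟨h₁.2.some.append h₂.2.some⟩⟩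
  precomp _ _ _ _ _ h r := ⟨h.1, ⟨h.2.some.shift r⟩⟩
  postcomp _ b c _ _ h r := by
    obtain ⟨rfl, ⟨ch⟩⟩ := h
    obtain rfl : c = b := eq_of_path_of_isEmpty_hom hout r
    obtain rfl : r = Path.nil := path_eq_nil_of_isEmpty_hom hout r
    exact ⟨rfl, ⟨ch⟩⟩

/-- Bookkeeping for the third axiom: whiskering on the right with `𝒟_[nil]` inside the `eqToHom`s of the axiom gives
back the left-whiskered homotopy, componentwise. [folklore] -/
private theorem whisker_nil_app {c a : V} (r₁ : Path c a) {p q : Path a ω} (α : D.pathFunctor p ⟶ D.pathFunctor q)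
    (h₁ : D.pathFunctor (r₁.comp (p.comp Path.nil)) = D.pathFunctor r₁ ⋙ D.pathFunctor p ⋙ D.pathFunctor Path.nil)
    (h₂ : D.pathFunctor r₁ ⋙ D.pathFunctor q ⋙ D.pathFunctor Path.nil = D.pathFunctor (r₁.comp (q.comp Path.nil)))
    (x : D.obj c) :
    (eqToHom h₁ ≫ Functor.whiskerLeft (D.pathFunctor r₁)
        (Functor.whiskerRight α (D.pathFunctor (Path.nil : Path ω ω))) ≫ eqToHom h₂).app x =
      eqToHom (D.pathFunctor_comp_obj r₁ p x) ≫ α.app ((D.pathFunctor r₁).obj x) ≫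
        eqToHom (D.pathFunctor_comp_obj r₁ q x).symm := by
  rw [app_eqToHom_whisker, D.pathFunctor_nil_map]
  simp only [Category.assoc, eqToHom_trans, eqToHom_trans_assoc]
  rfl

include thin in
/-- The homotopy attached to a boundary pair is that of ANY chain joining it. [cite: MochizukiAbsTopIII2015, Definition 3.5 (ii) p.75] -/
private theorem hom_some_eq {a b : V} {p q : Path a b} (h : ChainRel Gen ω p q) (c : Chain Gen p q) :
    Chain.hom genHom h.2.some = c.hom genHom := by
  obtain ⟨rfl, hc⟩ := h
  exact thin _ _ _ _

include hout thin in
/-- **The family of homotopies generated by the moves** (Def. 3.5 (ii)): boundary set = pairs into the sink vertex `ω`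
joined by a chain of moves, homotopy = the composite along ANY chain — well defined by the coherence hypothesis
`thin` (any two chains between the same pair of paths have the same homotopy); identity on the diagonal, composition
and whiskering then hold by construction. [cite: MochizukiAbsTopIII2015, Definition 3.5 (ii) p.75] -/
noncomputable def chainFamily : D.HomotopyFamily where
  E := ChainRel Gen ω
  isSaturated := chainRel_isSaturated Gen ω hout
  η := fun _ _ _ _ h => Chain.hom genHom h.2.some
  η_refl := by
    intro a b p h
    exact (hom_some_eq D Gen genHom ω thin h (Chain.nil p)).trans (Chain.hom_nil genHom p)
  η_trans := by
    intro a b p q r h₁ h₂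
    exact (hom_some_eq D Gen genHom ω thin ((chainRel_isSaturated Gen ω hout).trans h₁ h₂)
      (h₁.2.some.append h₂.2.some)).trans (Chain.hom_append genHom _ _)
  η_whisker := by
    rintro a b c d p q h r₁ r₂
    obtain rfl := h.1
    have hd := eq_of_path_of_isEmpty_hom hout r₂
    subst hd
    have hr := path_eq_nil_of_isEmpty_hom hout r₂
    subst hr
    ext x
    refine (NatTrans.congr_app (hom_some_eq D Gen genHom _ thin
      ((chainRel_isSaturated Gen _ hout).precomp ((chainRel_isSaturated Gen _ hout).postcomp h Path.nil) r₁)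
      (h.2.some.shift r₁)) x).trans ?_
    erw [Chain.hom_shift_app, whisker_nil_app]

/-- The boundary set of the generated family. [cite: MochizukiAbsTopIII2015, Definition 3.5 (ii) p.75] -/
theorem chainFamily_E {a b : V} (p q : Path a b) :
    (chainFamily D Gen genHom ω hout thin).E p q ↔ b = ω ∧ Nonempty (Chain Gen p q) := Iff.rfl

/-- Every boundary path ends at `ω` (the family is an OBSERVABLE family for `ω`, Def. 3.5 (iii) (c)).
[cite: MochizukiAbsTopIII2015, Definition 3.5 (iii) p.75] -/
theorem chainFamily_terminal ⦃a b : V⦄ ⦃p q : Path a b⦄ (h : (chainFamily D Gen genHom ω hout thin).E p q) :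
    b = ω := h.1

/-- A chain of moves is a boundary pair. [cite: MochizukiAbsTopIII2015, Definition 3.5 (ii) p.75] -/
theorem chainFamily_mem {a : V} {p q : Path a ω} (c : Chain Gen p q) :
    (chainFamily D Gen genHom ω hout thin).E p q := ⟨rfl, ⟨c⟩⟩

/-- The homotopies of the generated family are computed by ANY chain.
[cite: MochizukiAbsTopIII2015, Definition 3.5 (ii) p.75] -/
theorem chainFamily_η {a : V} {p q : Path a ω} (h : (chainFamily D Gen genHom ω hout thin).E p q)
    (c : Chain Gen p q) : (chainFamily D Gen genHom ω hout thin).η h = c.hom genHom :=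
  thin _ _ _ _

/-- In particular a single generator pair `(g, g')` is a boundary pair whose homotopy is the generator's (the casts
are identities between the two ends of the defining equation `𝒟_[nil] = 𝟭`).
[cite: MochizukiAbsTopIII2015, Definition 3.5 (ii) p.75] -/
theorem chainFamily_η_gen {c : V} {g g' : Path c ω} (s : Gen g g') (x : D.obj c) :
    ∃ (h : (chainFamily D Gen genHom ω hout thin).E g g')
      (e : (D.pathFunctor g).obj x = (D.pathFunctor g).obj ((D.pathFunctor (Path.nil : Path c c)).obj x))
      (e' : (D.pathFunctor g').obj ((D.pathFunctor (Path.nil : Path c c)).obj x) = (D.pathFunctor g').obj x),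
      ((chainFamily D Gen genHom ω hout thin).η h).app x =
        eqToHom e ≫ (genHom s).app ((D.pathFunctor (Path.nil : Path c c)).obj x) ≫ eqToHom e' := by
  let m : Move Gen g g' := ⟨c, Path.nil, g, g', s, (Path.nil_comp g).symm, (Path.nil_comp g').symm⟩
  refine ⟨chainFamily_mem D Gen genHom ω hout thin (Chain.cons m (Chain.nil g')),
    by rw [pathFunctor_nil]; rfl, by rw [pathFunctor_nil]; rfl, ?_⟩
  rw [chainFamily_η D Gen genHom ω hout thin _ (Chain.cons m (Chain.nil g')), Chain.hom_cons, Chain.hom_nil,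
    Category.comp_id]
  exact D.moveHom_app Path.nil (genHom s) m.hp m.hp' x

end Family

end DiagramOfCategories

end Literature.AnabelianGeometry.AbsoluteAnabelian
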